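import Summits.HodgeConjecture.HodgeConjecture.Theorems.F0P3cStCharTSHCDSlodowySliceFinal   -- ★ D5(iii) at `r = 1∕4` (A-p12): brings ★ FILE B `…SlodowySliceAssembly` (§1 vertex engine, §2 logic, §4 classification), ★ FILE C `exists_slice_transfers`, ★ (iii-K), ★ (AD), ★ (E), ★ (F)
import Summits.HodgeConjecture.HodgeConjecture.Theorems.K2E3HCDLieGlobalRpow                -- ★ (ε4) p856904 (this seat): `continuous_eta_rpow`, `eta_rpow_smul`; brings ★ (ε5) `coe_rpow_neg_quarter`, ★ (D3b) `coe_inv_residueFieldCard_pow_rpow_neg_lt`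
import Mathlib.Analysis.SpecialFunctions.Pow.Continuity
import HarnessLib

/-!
# K2 · E3 · (SC-an) sub-line «HC-D-ε», file (ε2): THE SLODOWY-SLICE LEAF OF ROAD «HC-D» AT A REAL EXPONENT `r`
# (`ηᵣ X = (↑|discr χ_X|_K)^(−r)` is locally `∫⁻`-finite at every non-zero SQUARE-ZERO point of `↥𝔲₀`, given the strata (i) `hreg`, (ii) `hss`; `12 r < 5`)

Cell `pub/hodgecm-mathlib`, crux H413 = `stmt-HodgeConjecture-24833` (lane `--supports … --as helper`); seat K2E3-p21 (g3) (HC-D-ε sub-lead; (ε2) self-taken, ruling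
ε-R1 03:03:47Z), (SC-an) line lead K2E3-p14 (g3), dealer K2E3-plan (g2).  Exponent-parametric twin of ★ `F0P3cStCharTSHCDSlodowySliceAssembly` §3 + §5 and ★
`F0P3cStCharTSHCDSlodowySliceFinal` (A-p12) under the SUB-LINE CONVENTION of (ε5) (`ηᵣ X := ((normAbs K (charpoly X).discr : ℝ≥0∞)) ^ (-r)`; the ★ `√√`-token is `r = 1∕4`).
The exponent-free ★ bricks are reused BY NAME: FILE B §1 `exists_nhds_setLIntegral_lt_top_of_homogeneous_pi_nhds` (the local weighted-homogeneous vertex engine on `ι → F′`),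
§4 `slice_point_regular_or_type_aab`, FILE C `exists_slice_transfers` (DOWN ∕ UP for ANY continuous class function), ★ (CO) `exists_coords_slice`, ★ (iii-K), ★ (F), ★ (E) Witt,
★ (AD) `exists_nhds_setLIntegral_lt_top_iff_ad`.  THEOREMS ONLY; sorry-free; no definition ∕ instance ∕ notation.

THE MATHEMATICS ([HarishChandra1970] Part VII §1 Thm. 15 for `U(3)` by Slodowy slices; [Slodowy1980] §7.4).  At the minimal nilpotent `N = c·E₀₂` the slice `N + C`,
`C = 𝔲₀ ∩ 𝔷(E₂₀)` (`F′`-dimension `4`, ★ (CO) chart `Φ_S` with weights `(2,3,3,4)`, Haar modulus `q⁻¹²` under `ρ_ϖ`), carries the integrand `F Z := ηᵣ(N + Z)` with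
**`F ∘ ρ_ϖ = q^{24 r} · F`** (§1: `disc χ` is conjugation invariant and homogeneous of degree `6`, the scalar is `(ι ϖ)²`, `|ι ϖ|_K = q⁻²`): the vertex engine needs
`q^{24 r} < q¹²`, i.e. **`2 r < 1`** (implied by the sub-line's `12 r < 5`; at `r = 1∕4` this is ★'s `q⁶ < q¹²`).  §2 the vertex on the slice; §3 the assembly at `N`
(vertex + classification + (i)(ii) + DOWN∕UP); §4 the model point `N = c·E₀₂` with the carriers `Q`, `C`, the descended chart and its Newton data built inside the proof
exactly as ★ FILE D §1; §5 every non-zero square-zero `X₀` by ★ (E) Witt + ★ (AD) — the HEAD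
**`exists_nhds_setLIntegral_eta_rpow_lt_top_of_sq_zero (σ hσ hσc h3 ι hι hιr lam hlam) (hJ) (𝔲₀ h𝔲₀ μ₀) {r} (hr5 : 12 r < 5) (hreg) (hss) : ∀ X₀ ≠ 0, X₀² = 0 → ∃ U ∈ 𝓝 X₀, ∫⁻_U ηᵣ ∂μ₀ < ∞`**
= ★ `…SlodowySliceFinal.exists_nhds_setLIntegral_etaInv_lt_top_of_sq_zero` binders + `{r} (hr5)` before `hreg`, tokens (T1) — the `hsq` binder of (ε6)
`K2E3HCDModelRpow.exists_nhds_setLIntegral_theta_rpow_lt_top_model₂` (the `r = 1∕4` instance is the ★ head by (ε5) `coe_rpow_neg_quarter`).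
HONEST LABEL: count-neutral; closes no organ; HC_CM is proved only modulo the 7 printed citations (2 remaining named inputs: hLiu418 = `stmt-HodgeConjecture-24832`,
h413 = `stmt-HodgeConjecture-24833`) until rung 0 closes; (SC-an) is NOT ★.

## References
* [HarishChandra1970] Harish-Chandra (notes by G. van Dijk), *Harmonic analysis on reductive p-adic groups*, LNM 162 (1970), Part VII §1 Thm. 15; Part V §4 Lemma 22.
* [Slodowy1980] P. Slodowy, *Simple Singularities and Simple Algebraic Groups*, LNM 815 (1980), §7.4.
* [Tate1950] J. Tate, *Fourier analysis in number fields and Hecke's zeta-functions* (1950), §2.4.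
* [Rogawski1990] J. D. Rogawski, *Automorphic Representations of Unitary Groups in Three Variables* (1990), §1.9 p. 8; §4.9 p. 54.
-/

set_option autoImplicit false
set_option linter.dupNamespace false

noncomputable section

open MeasureTheory MeasureTheory.Measure Filter Set Topology Matrix
open scoped Matrix Matrix.Norms.Elementwise ENNReal NNReal Pointwise
open Literature.NumberTheory.GaloisRepresentations Literature.NumberTheory.GaloisRepresentations.IsNonarchimedeanLocalField
open Literature.NumberTheory.Automorphic Literature.NumberTheory.Automorphic.LocalFieldHaar
open Literature.MeasureTheory.Integral Literature.MeasureTheory.Group Literature.LinearAlgebra.Matrix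
open Summit.HodgeConjecture.HodgeConjecture.Cruxes.H413.F0P3cStCharTSHCDCoordinates
open Summit.HodgeConjecture.HodgeConjecture.Cruxes.H413.F0P3cStCharTSHCDLieGlobal
open Summit.HodgeConjecture.HodgeConjecture.Cruxes.H413.F0P3cStCharTSHCDSlodowySliceAssembly
open Summit.HodgeConjecture.HodgeConjecture.Cruxes.H413.F0P3cStCharTSHCDSlodowySliceChart
open Summit.HodgeConjecture.HodgeConjecture.Cruxes.H413.F0P3cStCharTSHCDSlodowySliceK
open Summit.HodgeConjecture.HodgeConjecture.Cruxes.H413.F0P3cStCharTSHCDAdTransport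
open Summit.HodgeConjecture.HodgeConjecture.Cruxes.H413.F0P3cStCharTSHCDescentSemisimpleSliceK
open Summit.HodgeConjecture.HodgeConjecture.Cruxes.H413.F0P3cStCharTSQuadraticFormNegHalf
open Summit.HodgeConjecture.HodgeConjecture.Cruxes.H413.K2E3HCDGroupToLieRpow
open Summit.HodgeConjecture.HodgeConjecture.Cruxes.H413.K2E3HCDLieGlobalRpow

namespace Summit.HodgeConjecture.HodgeConjecture.Cruxes.H413.K2E3HCDSlodowySliceRpow

/-! ## §1 Homogeneity of `ηᵣ` under the contracting torus -/

section Torus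

variable {K : Type*} [Field K] [ValuativeRel K] [TopologicalSpace K] [IsNonarchimedeanLocalField K]

/-- **Homogeneity of `ηᵣ` under the contracting torus through the slice chart**: with `P = diag(s⁻¹, 1, s)`, `Q = diag(s, 1, s⁻¹)` (`Q P = 1`) and the scalar `s²`,
`ηᵣ (s² • (P M Q)) = (↑(|s|¹²))^(−r) · ηᵣ M` for every real `r` (`charpoly (P M Q) = charpoly M`, ★ (ε4) `eta_rpow_smul`: degree-`6` homogeneity). [cite: Rogawski1990, §4.9 p. 54] -/
theorem eta_rpow_torus (s : K) (hs : s ≠ 0) (M : Matrix (Fin 3) (Fin 3) K) (r : ℝ) :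
    ((normAbs K (Matrix.charpoly ((s ^ 2) • (Matrix.diagonal ![s⁻¹, 1, s] * M * Matrix.diagonal ![s, 1, s⁻¹]))).discr : ℝ≥0∞)) ^ (-r) =
      ((normAbs K s ^ 12 : ℝ≥0) : ℝ≥0∞) ^ (-r) * ((normAbs K (Matrix.charpoly M).discr : ℝ≥0∞)) ^ (-r) := by
  have hQP : Matrix.diagonal ![s, 1, s⁻¹] * Matrix.diagonal ![s⁻¹, 1, s] = 1 := by
    rw [Matrix.diagonal_mul_diagonal, ← Matrix.diagonal_one]
    congr 1
    funext i
    fin_cases i <;> simp [hs]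
  have hchar : Matrix.charpoly (Matrix.diagonal ![s⁻¹, 1, s] * M * Matrix.diagonal ![s, 1, s⁻¹]) = Matrix.charpoly M := by
    rw [Matrix.mul_assoc, Matrix.charpoly_mul_comm, Matrix.mul_assoc, hQP, Matrix.mul_one]
  rw [eta_rpow_smul (s ^ 2) _ r, hchar, map_pow, ← pow_mul]

end Torus

/-! ## §2 The vertex on the Slodowy slice `C = 𝔲₀ ∩ 𝔷(E₂₀)` at exponent `r` (`2 r < 1`) -/

section SliceVertex

variable {K : Type*} [Field K] [ValuativeRel K] [TopologicalSpace K] [IsNonarchimedeanLocalField K]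
  (σ : K →+* K) (hσ : ∀ x, σ (σ x) = x) [Invertible (2 : K)]
  {F' : Type*} [Field F'] [ValuativeRel F'] [TopologicalSpace F'] [IsNonarchimedeanLocalField F']
  (ι : F' →+* K) (hι : IsClosedEmbedding ι) (hιr : ∀ x, σ x = x ↔ x ∈ Set.range ι)
  (lam : Kˣ) (hlam : σ lam = -lam)

set_option maxHeartbeats 800000 in
-- the slice-chart entry clauses and the `Fin 4 → F′` coordinate transport make elaboration long, not deep (as ★ FILE B §3)
include hσ ι hι hιr lam hlam in
/-- **THE VERTEX ON THE SLODOWY SLICE AT EXPONENT `r`.**  `C = 𝔲₀ ∩ 𝔷(E₂₀)` (membership clause `hC` as ★ (CO) prints it, `J = J₃`), `μC` ANY additive Haar measure on `↥C`,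
`N = c·E₀₂`, `F Z := ηᵣ (N + Z)`, `2 r < 1`.  IF `F` has finite integral near every `Z ≠ 0` of some neighbourhood `W` of `0` in `↥C`, THEN near `0` too.  Proof: in the ★ (CO)
coordinates `Φ_S : (Fin 4 → F′) ≃ₜ+ ↥C` the contraction `ρ_ϖ` is the dilation `(ϖ², ϖ³, ϖ³, ϖ⁴)` (`Σ k = 12`), it fixes `N` (★ `torus_conj_single_zero_two`) and
`F ∘ ρ_ϖ = q^{24 r} · F` (§1 + ★ (NB) `|ι ϖ|_K = q⁻²`); `q^{24 r} < q¹²` (★ (D3b) `coe_inv_residueFieldCard_pow_rpow_neg_lt`), so ★ FILE B §1 applies on `Fin 4 → F′`, and ★ (G-FUB)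
moves local finiteness along `Φ_S` both ways. [cite: HarishChandra1970, Part VII §1 Thm. 15] [cite: Slodowy1980, §7.4] [cite: Tate1950, §2.4] -/
theorem exists_nhds_zero_setLIntegral_eta_rpow_lt_top_slice
    {J : Matrix (Fin 3) (Fin 3) K} (hJ : J = !![0, 0, 1; 0, 1, 0; 1, 0, 0]) (c : K)
    (C : AddSubgroup (Matrix (Fin 3) (Fin 3) K))
    (hC : ∀ X, X ∈ C ↔ ((X.map σ)ᵀ * J + J * X = 0 ∧ Matrix.trace X = 0) ∧
      X * Matrix.single (2 : Fin 3) (0 : Fin 3) (1 : K) = Matrix.single (2 : Fin 3) (0 : Fin 3) 1 * X)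
    [MeasurableSpace ↥C] [BorelSpace ↥C] (μC : Measure ↥C) [μC.IsAddHaarMeasure] {r : ℝ} (hr2 : 2 * r < 1)
    {W : Set ↥C} (hW : W ∈ 𝓝 (0 : ↥C))
    (hgood : ∀ Z ∈ W, Z ≠ 0 → ∃ U ∈ 𝓝 Z, ∫⁻ Z' in U,
      ((normAbs K (Matrix.charpoly (Matrix.single (0 : Fin 3) (2 : Fin 3) c + (Z' : Matrix (Fin 3) (Fin 3) K))).discr : ℝ≥0∞)) ^ (-r) ∂μC < ∞) :
    ∃ U ∈ 𝓝 (0 : ↥C), ∫⁻ Z in U,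
      ((normAbs K (Matrix.charpoly (Matrix.single (0 : Fin 3) (2 : Fin 3) c + (Z : Matrix (Fin 3) (Fin 3) K))).discr : ℝ≥0∞)) ^ (-r) ∂μC < ∞ := by
  classical
  -- the slice chart
  obtain ⟨Φ, -, -, hΦw⟩ := exists_coords_slice σ hσ hJ ι hι hιr lam hlam C hC
  -- instances on the coordinate space `Fin 4 → F′` and on `↥C`
  haveI : T2Space F' := (Literature.NumberTheory.GaloisRepresentations.IsNonarchimedeanLocalField.isLocalField F').toT2Space
  haveI := secondCountableTopology_localField F'
  letI : MeasurableSpace F' := borel F'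
  haveI : BorelSpace F' := ⟨rfl⟩
  haveI : LocallyCompactSpace ↥C := Φ.toHomeomorph.symm.isClosedEmbedding.locallyCompactSpace
  haveI : SecondCountableTopology ↥C := Φ.toHomeomorph.symm.secondCountableTopology
  set ν : Measure (Fin 4 → F') := Measure.addHaar with hν
  -- the integrand on the slice
  set F : ↥C → ℝ≥0∞ := fun Z =>
    ((normAbs K (Matrix.charpoly (Matrix.single (0 : Fin 3) (2 : Fin 3) c + (Z : Matrix (Fin 3) (Fin 3) K))).discr : ℝ≥0∞)) ^ (-r) with hFdef
  -- a uniformizer of `F′`, the weights and the contraction ratio `q^{24 r}`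
  obtain ⟨ϖ, hϖ0, hϖ⟩ := exists_normAbs_eq_inv (F := F')
  have hιϖ0 : ι ϖ ≠ 0 := (map_ne_zero ι).2 hϖ0
  have hιn : normAbs K (ι ϖ) = (residueFieldCard F' : ℝ≥0)⁻¹ ^ 2 := by
    rw [Literature.NumberTheory.LocalFields.normAbs_map_eq_sq_of_involution ι hι.continuous σ hσ hιr lam hlam ϖ, hϖ]
  set a : Fin 4 → F' := ![ϖ ^ 2, ϖ ^ 3, ϖ ^ 3, ϖ ^ 4] with hadef
  set k : Fin 4 → ℕ := ![2, 3, 3, 4] with hkdef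
  have hk : ∀ i, 1 ≤ k i := fun i => by fin_cases i <;> simp [hkdef]
  have ha : ∀ i, normAbs F' (a i) = ((residueFieldCard F' : ℝ≥0)⁻¹) ^ k i := fun i => by
    fin_cases i <;> simp [hadef, hkdef, map_pow, hϖ]
  have hsum : (∑ i, k i) = 12 := by simp [hkdef, Fin.sum_univ_four]
  set cst : ℝ≥0∞ := ((((residueFieldCard F' : ℝ≥0))⁻¹ ^ 24 : ℝ≥0) : ℝ≥0∞) ^ (-r) with hcst
  have hc : cst < (residueFieldCard F' : ℝ≥0∞) ^ (∑ i, k i) := by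
    rw [hsum, hcst]
    exact coe_inv_residueFieldCard_pow_rpow_neg_lt (F := F') (by push_cast; linarith)
  -- the contraction fixes `N` and acts on the slice through the weights
  have hN : ((ι ϖ) ^ 2) • (Matrix.diagonal ![(ι ϖ)⁻¹, 1, ι ϖ] * Matrix.single (0 : Fin 3) (2 : Fin 3) c * Matrix.diagonal ![ι ϖ, 1, (ι ϖ)⁻¹]) =
      Matrix.single (0 : Fin 3) (2 : Fin 3) c := by
    have h := torus_conj_single_zero_two (Units.mk0 (ι ϖ) hιϖ0) c
    simpa only [Units.val_mk0, Units.val_inv_eq_inv_val] using h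
  -- homogeneity in coordinates: `F (Φ (a • x)) = q^{24 r} · F (Φ x)`
  have hhom : ∀ x : Fin 4 → F', x ∈ Φ ⁻¹' W → x ≠ 0 → F (Φ (fun i => a i * x i)) ≤ cst * F (Φ x) := by
    intro x _ _
    have hax : (fun i => a i * x i) = ![ϖ ^ 2 * x 0, ϖ ^ 3 * x 1, ϖ ^ 3 * x 2, ϖ ^ 4 * x 3] := by
      funext i; fin_cases i <;> simp [hadef]
    have hmat : Matrix.single (0 : Fin 3) (2 : Fin 3) c + ((Φ (fun i => a i * x i) : ↥C) : Matrix (Fin 3) (Fin 3) K) =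
        ((ι ϖ) ^ 2) • (Matrix.diagonal ![(ι ϖ)⁻¹, 1, ι ϖ] * (Matrix.single (0 : Fin 3) (2 : Fin 3) c + ((Φ x : ↥C) : Matrix (Fin 3) (Fin 3) K)) *
          Matrix.diagonal ![ι ϖ, 1, (ι ϖ)⁻¹]) := by
      rw [hax, ← hΦw ϖ hϖ0 x, Matrix.mul_add, Matrix.add_mul, smul_add, hN]
    apply le_of_eq
    simp only [hFdef]
    rw [hmat, eta_rpow_torus (ι ϖ) hιϖ0 _ r, hιn,
      show (((residueFieldCard F' : ℝ≥0))⁻¹ ^ 2) ^ 12 = ((residueFieldCard F' : ℝ≥0))⁻¹ ^ 24 by ring, hcst]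
  -- off-zero finiteness in coordinates
  have hΦc : Continuous (fun x : Fin 4 → F' => Φ x) := Φ.continuous
  have hW0 : W ∈ 𝓝 (Φ 0) := by rw [map_zero]; exact hW
  have hU₀ : Φ ⁻¹' W ∈ 𝓝 (0 : Fin 4 → F') := hΦc.continuousAt.preimage_mem_nhds hW0
  have hoff : ∀ y ∈ Φ ⁻¹' W, y ≠ 0 → ∃ U ∈ 𝓝 y, ∫⁻ x in U, F (Φ x) ∂ν < ∞ := by
    intro y hy hy0
    have hΦy : Φ y ≠ 0 := fun h => hy0 (Φ.injective (by rw [h, map_zero]))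
    exact (exists_nhds_setLIntegral_lt_top_iff_of_addEquiv Φ ν μC F y).1 (hgood (Φ y) hy hΦy)
  -- ★ FILE B §1 on the coordinate space, then back to `↥C`
  have h0 := exists_nhds_setLIntegral_lt_top_of_homogeneous_pi_nhds ν a k hk ha (fun x => F (Φ x)) cst hc hU₀ hhom hoff
  have h := (exists_nhds_setLIntegral_lt_top_iff_of_addEquiv Φ ν μC F 0).2 h0
  rwa [map_zero] at h

end SliceVertex

/-! ## §3 The assembly at the vertex `N = c·E₀₂` (modulo the slice identities DOWN ∕ UP of ★ FILE C) -/

section Assembly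

variable {K : Type*} [Field K] [ValuativeRel K] [TopologicalSpace K] [IsNonarchimedeanLocalField K]
  (σ : K →+* K) (hσ : ∀ x, σ (σ x) = x) [Invertible (2 : K)] (h3 : (3 : K) ≠ 0)
  {F' : Type*} [Field F'] [ValuativeRel F'] [TopologicalSpace F'] [IsNonarchimedeanLocalField F']
  (ι : F' →+* K) (hι : IsClosedEmbedding ι) (hιr : ∀ x, σ x = x ↔ x ∈ Set.range ι)
  (lam : Kˣ) (hlam : σ lam = -lam)

set_option maxHeartbeats 800000 in
-- long statement (three integrands); elaboration of the subtype coercions dominates (as ★ FILE B §5)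
include hσ ι hι hιr lam hlam h3 in
/-- **ASSEMBLY AT A MINIMAL NILPOTENT `N = c·E₀₂`, EXPONENT `r`** (`σ c = −c`, `c ≠ 0`; `J = J₃`; `𝔲₀` trace-free skew, `C = 𝔲₀ ∩ 𝔷(E₂₀)`, any additive Haar measures
`μ₀`, `μC`; `2 r < 1`).  HYPOTHESES: the strata (i) `hreg`, (ii) `hss` on `↥𝔲₀` with the token `ηᵣ`, and the two slice identities of ★ FILE C read as transfers on a
neighbourhood `W` of `0` in `↥C` (DOWN, UP).  CONCLUSION: `ηᵣ` has finite `μ₀`-integral near `N` (★ FILE B §2 logic with VERTEX = §2, GOOD = ★ §4 classification + (i)(ii)).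
[cite: HarishChandra1970, Part VII §1 Thm. 15; Part V §4 Lemma 22] [cite: Slodowy1980, §7.4] -/
theorem exists_nhds_setLIntegral_eta_rpow_lt_top_of_slice_transfers
    {J : Matrix (Fin 3) (Fin 3) K} (hJ : J = !![0, 0, 1; 0, 1, 0; 1, 0, 0]) {c : K} (hc : σ c = -c) (hc0 : c ≠ 0)
    (𝔲₀ : AddSubgroup (Matrix (Fin 3) (Fin 3) K)) (h𝔲₀ : ∀ X, X ∈ 𝔲₀ ↔ (X.map σ)ᵀ * J + J * X = 0 ∧ Matrix.trace X = 0)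
    [MeasurableSpace ↥𝔲₀] [BorelSpace ↥𝔲₀] (μ₀ : Measure ↥𝔲₀) [μ₀.IsAddHaarMeasure]
    (C : AddSubgroup (Matrix (Fin 3) (Fin 3) K))
    (hC : ∀ X, X ∈ C ↔ ((X.map σ)ᵀ * J + J * X = 0 ∧ Matrix.trace X = 0) ∧
      X * Matrix.single (2 : Fin 3) (0 : Fin 3) (1 : K) = Matrix.single (2 : Fin 3) (0 : Fin 3) 1 * X)
    [MeasurableSpace ↥C] [BorelSpace ↥C] (μC : Measure ↥C) [μC.IsAddHaarMeasure] {r : ℝ} (hr2 : 2 * r < 1)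
    (hreg : ∀ X₀ : ↥𝔲₀, LinearIndependent K ![(1 : Matrix (Fin 3) (Fin 3) K), (X₀ : Matrix (Fin 3) (Fin 3) K), (X₀ : Matrix (Fin 3) (Fin 3) K) ^ 2] →
      ∃ U ∈ 𝓝 X₀, ∫⁻ X in U, ((normAbs K (Matrix.charpoly (X : Matrix (Fin 3) (Fin 3) K)).discr : ℝ≥0∞)) ^ (-r) ∂μ₀ < ∞)
    (hss : ∀ X₀ : ↥𝔲₀, (∃ a b : K, a ≠ b ∧ ((X₀ : Matrix (Fin 3) (Fin 3) K) - a • (1 : Matrix (Fin 3) (Fin 3) K)) * ((X₀ : Matrix (Fin 3) (Fin 3) K) - b • 1) = 0 ∧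
        ∀ a' : K, (X₀ : Matrix (Fin 3) (Fin 3) K) ≠ a' • 1) →
      ∃ U ∈ 𝓝 X₀, ∫⁻ X in U, ((normAbs K (Matrix.charpoly (X : Matrix (Fin 3) (Fin 3) K)).discr : ℝ≥0∞)) ^ (-r) ∂μ₀ < ∞)
    {W : Set ↥C} (hW : W ∈ 𝓝 (0 : ↥C))
    (hdown : ∀ Z ∈ W, Z ≠ 0 → ∀ X₀ : ↥𝔲₀, (X₀ : Matrix (Fin 3) (Fin 3) K) = Matrix.single (0 : Fin 3) (2 : Fin 3) c + (Z : Matrix (Fin 3) (Fin 3) K) →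
      (∃ U ∈ 𝓝 X₀, ∫⁻ X in U, ((normAbs K (Matrix.charpoly (X : Matrix (Fin 3) (Fin 3) K)).discr : ℝ≥0∞)) ^ (-r) ∂μ₀ < ∞) →
      ∃ U ∈ 𝓝 Z, ∫⁻ Z' in U,
        ((normAbs K (Matrix.charpoly (Matrix.single (0 : Fin 3) (2 : Fin 3) c + (Z' : Matrix (Fin 3) (Fin 3) K))).discr : ℝ≥0∞)) ^ (-r) ∂μC < ∞)
    (hup : (∃ U ∈ 𝓝 (0 : ↥C), ∫⁻ Z' in U,
        ((normAbs K (Matrix.charpoly (Matrix.single (0 : Fin 3) (2 : Fin 3) c + (Z' : Matrix (Fin 3) (Fin 3) K))).discr : ℝ≥0∞)) ^ (-r) ∂μC < ∞) →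
      ∀ X₀ : ↥𝔲₀, (X₀ : Matrix (Fin 3) (Fin 3) K) = Matrix.single (0 : Fin 3) (2 : Fin 3) c →
        ∃ U ∈ 𝓝 X₀, ∫⁻ X in U, ((normAbs K (Matrix.charpoly (X : Matrix (Fin 3) (Fin 3) K)).discr : ℝ≥0∞)) ^ (-r) ∂μ₀ < ∞) :
    ∀ X₀ : ↥𝔲₀, (X₀ : Matrix (Fin 3) (Fin 3) K) = Matrix.single (0 : Fin 3) (2 : Fin 3) c →
      ∃ U ∈ 𝓝 X₀, ∫⁻ X in U, ((normAbs K (Matrix.charpoly (X : Matrix (Fin 3) (Fin 3) K)).discr : ℝ≥0∞)) ^ (-r) ∂μ₀ < ∞ := by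
  subst hJ
  have h2 : (2 : K) ≠ 0 := Invertible.ne_zero 2
  -- `N ∈ 𝔲₀`
  have hNmem : Matrix.single (0 : Fin 3) (2 : Fin 3) c ∈ 𝔲₀ := by
    refine (h𝔲₀ _).2 ⟨(UnitaryThreeWitt.single_zero_two_mem_iff σ c).2 (by rw [hc]; ring), ?_⟩
    exact Matrix.trace_single_eq_of_ne (0 : Fin 3) (2 : Fin 3) c (by decide)
  -- GOOD: every slice point off the vertex is regular or of type `(a,a,b)`, hence covered by (i) ∕ (ii)
  have hgoodU : ∀ Z ∈ W, Z ≠ 0 → ∀ X₀ : ↥𝔲₀, (X₀ : Matrix (Fin 3) (Fin 3) K) = Matrix.single (0 : Fin 3) (2 : Fin 3) c + (Z : Matrix (Fin 3) (Fin 3) K) →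
      ∃ U ∈ 𝓝 X₀, ∫⁻ X in U, ((normAbs K (Matrix.charpoly (X : Matrix (Fin 3) (Fin 3) K)).discr : ℝ≥0∞)) ^ (-r) ∂μ₀ < ∞ := by
    intro Z _ hZ0 X₀ hX₀
    obtain ⟨⟨_, hZtr⟩, hZcomm⟩ := (hC _).1 Z.2
    have hZ0' : (Z : Matrix (Fin 3) (Fin 3) K) ≠ 0 := fun h => hZ0 (Subtype.ext h)
    have htr : Matrix.trace (Matrix.single (0 : Fin 3) (2 : Fin 3) c + (Z : Matrix (Fin 3) (Fin 3) K)) = 0 := by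
      rw [Matrix.trace_add, Matrix.trace_single_eq_of_ne (0 : Fin 3) (2 : Fin 3) c (by decide), hZtr, add_zero]
    rcases slice_point_regular_or_type_aab hc0 h2 h3 hZcomm hZ0' htr with hli | ⟨a, b, hab, hprod, hns⟩
    · exact hreg X₀ (by rw [hX₀]; exact hli)
    · exact hss X₀ ⟨a, b, hab, by rw [hX₀]; exact hprod, by rw [hX₀]; exact hns⟩
  -- GOOD on the slice: the `C`-finiteness at every `Z ∈ W ∖ {0}` (DOWN)
  have hgoodC : ∀ Z ∈ W, Z ≠ 0 → ∃ U ∈ 𝓝 Z, ∫⁻ Z' in U,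
      ((normAbs K (Matrix.charpoly (Matrix.single (0 : Fin 3) (2 : Fin 3) c + (Z' : Matrix (Fin 3) (Fin 3) K))).discr : ℝ≥0∞)) ^ (-r) ∂μC < ∞ := by
    intro Z hZ hZ0
    obtain ⟨⟨hZskew, hZtr⟩, _⟩ := (hC _).1 Z.2
    have hmem : Matrix.single (0 : Fin 3) (2 : Fin 3) c + (Z : Matrix (Fin 3) (Fin 3) K) ∈ 𝔲₀ :=
      𝔲₀.add_mem hNmem ((h𝔲₀ _).2 ⟨hZskew, hZtr⟩)
    exact hdown Z hZ hZ0 ⟨_, hmem⟩ rfl (hgoodU Z hZ hZ0 ⟨_, hmem⟩ rfl)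
  -- VERTEX on the slice (§2), then UP
  exact hup (exists_nhds_zero_setLIntegral_eta_rpow_lt_top_slice σ hσ ι hι hιr lam hlam rfl c C hC μC hr2 hW hgoodC)

end Assembly

/-! ## §4 The model point `N = c·E₀₂`; §5 every non-zero square-zero point (Witt + `Ad`) -/

section Final

variable {K : Type*} [Field K] [ValuativeRel K] [TopologicalSpace K] [IsNonarchimedeanLocalField K]
  (σ : K →+* K) (hσ : ∀ x, σ (σ x) = x) (hσc : Continuous σ) [Invertible (2 : K)] (h3 : (3 : K) ≠ 0)
  {F' : Type*} [Field F'] [ValuativeRel F'] [TopologicalSpace F'] [IsNonarchimedeanLocalField F']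
  (ι : F' →+* K) (hι : IsClosedEmbedding ι) (hιr : ∀ x, σ x = x ↔ x ∈ Set.range ι)
  (lam : Kˣ) (hlam : σ lam = -lam)

set_option maxHeartbeats 1600000 in
-- long statements (three integrands, the `K`-carriers of (iii-K)); elaboration of the subtype coercions dominates (as ★ FILE D §1)
include hσ hσc ι hι hιr lam hlam h3 in
/-- **D5(iii)ᵣ AT THE MODEL POINT `N = c·E₀₂`** (`σ c = −c`, `c ≠ 0`; `J = J₃`; any additive Haar measure `μ₀` on `↥𝔲₀`; `12 r < 5`): given the strata (i) `hreg` and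
(ii) `hss` on `↥𝔲₀` with the token `ηᵣ`, `ηᵣ` has finite `μ₀`-integral on a neighbourhood of every `X₀ : ↥𝔲₀` with `↑X₀ = N`.  (★ (F) chart, ★ (iii-K) Newton data, ★ FILE C
transfers for the continuous class function `ηᵣ` (★ (ε4) `continuous_eta_rpow`), §3 assembly; the valuation norm, the carriers `Q`, `C` and their Haar measures live inside the proof —
★ FILE D §1 verbatim up to the weight.) [cite: HarishChandra1970, Part VII §1 Thm. 15; Part V §4 Lemma 22] [cite: Slodowy1980, §7.4] -/
theorem exists_nhds_setLIntegral_eta_rpow_lt_top_of_eq_single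
    {J : Matrix (Fin 3) (Fin 3) K} (hJ : J = !![0, 0, 1; 0, 1, 0; 1, 0, 0]) {c : K} (hc : σ c = -c) (hc0 : c ≠ 0)
    (𝔲₀ : AddSubgroup (Matrix (Fin 3) (Fin 3) K)) (h𝔲₀ : ∀ X, X ∈ 𝔲₀ ↔ (X.map σ)ᵀ * J + J * X = 0 ∧ Matrix.trace X = 0)
    [MeasurableSpace ↥𝔲₀] [BorelSpace ↥𝔲₀] (μ₀ : Measure ↥𝔲₀) [μ₀.IsAddHaarMeasure] {r : ℝ} (hr5 : 12 * r < 5)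
    (hreg : ∀ X₀ : ↥𝔲₀, LinearIndependent K ![(1 : Matrix (Fin 3) (Fin 3) K), (X₀ : Matrix (Fin 3) (Fin 3) K), (X₀ : Matrix (Fin 3) (Fin 3) K) ^ 2] →
      ∃ U ∈ 𝓝 X₀, ∫⁻ X in U, ((normAbs K (Matrix.charpoly (X : Matrix (Fin 3) (Fin 3) K)).discr : ℝ≥0∞)) ^ (-r) ∂μ₀ < ∞)
    (hss : ∀ X₀ : ↥𝔲₀, (∃ a b : K, a ≠ b ∧ ((X₀ : Matrix (Fin 3) (Fin 3) K) - a • (1 : Matrix (Fin 3) (Fin 3) K)) * ((X₀ : Matrix (Fin 3) (Fin 3) K) - b • 1) = 0 ∧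
        ∀ a' : K, (X₀ : Matrix (Fin 3) (Fin 3) K) ≠ a' • 1) →
      ∃ U ∈ 𝓝 X₀, ∫⁻ X in U, ((normAbs K (Matrix.charpoly (X : Matrix (Fin 3) (Fin 3) K)).discr : ℝ≥0∞)) ^ (-r) ∂μ₀ < ∞) :
    ∀ X₀ : ↥𝔲₀, (X₀ : Matrix (Fin 3) (Fin 3) K) = Matrix.single (0 : Fin 3) (2 : Fin 3) c →
      ∃ U ∈ 𝓝 X₀, ∫⁻ X in U, ((normAbs K (Matrix.charpoly (X : Matrix (Fin 3) (Fin 3) K)).discr : ℝ≥0∞)) ^ (-r) ∂μ₀ < ∞ := by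
  classical
  subst hJ
  have h2 : (2 : K) ≠ 0 := Invertible.ne_zero 2
  have hr2 : 2 * r < 1 := by linarith
  -- ===== R1 frame, inside the proof only =====
  letI : NontriviallyNormedField K := IsNonarchimedeanLocalField.nontriviallyNormedField K
  haveI : CompleteSpace K := IsNonarchimedeanLocalField.completeSpace_nontriviallyNormedField K
  haveI : IsUltrametricDist K := IsNonarchimedeanLocalField.isUltrametricDist_nontriviallyNormedField K
  haveI : ProperSpace K := ProperSpace.of_nontriviallyNormedField_of_weaklyLocallyCompactSpace K
  haveI : SecondCountableTopology K := secondCountable_of_proper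
  -- ===== the carriers `Q = 𝔲₀ ∩ range (ad E₂₀)`, `C = 𝔲₀ ∩ 𝔷(E₂₀)` (★ (iii-K) carriers) =====
  obtain ⟨Q, hQ⟩ : ∃ Q : AddSubgroup (Matrix (Fin 3) (Fin 3) K), ∀ Y, Y ∈ Q ↔ Y ∈ 𝔲₀ ∧ (Y 0 1 = 0 ∧ Y 0 2 = 0 ∧ Y 1 1 = 0 ∧ Y 1 2 = 0 ∧ Y 0 0 + Y 2 2 = 0) :=
    ⟨𝔲₀ ⊓ (LinearMap.range (LinearMap.mulLeft K (Matrix.single (2 : Fin 3) (0 : Fin 3) (1 : K)) - LinearMap.mulRight K (Matrix.single (2 : Fin 3) (0 : Fin 3) (1 : K)) :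
        Module.End K (Matrix (Fin 3) (Fin 3) K))).toAddSubgroup,
      fun Y => by rw [AddSubgroup.mem_inf, Submodule.mem_toAddSubgroup, mem_range_ad_single_two_zero_iff]⟩
  obtain ⟨C, hC⟩ : ∃ C : AddSubgroup (Matrix (Fin 3) (Fin 3) K), ∀ Z, Z ∈ C ↔ Z ∈ 𝔲₀ ∧
      Z * Matrix.single (2 : Fin 3) (0 : Fin 3) (1 : K) = Matrix.single (2 : Fin 3) (0 : Fin 3) 1 * Z :=
    ⟨𝔲₀ ⊓ (LinearMap.ker (LinearMap.mulLeft K (Matrix.single (2 : Fin 3) (0 : Fin 3) (1 : K)) - LinearMap.mulRight K (Matrix.single (2 : Fin 3) (0 : Fin 3) (1 : K)) :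
        Module.End K (Matrix (Fin 3) (Fin 3) K))).toAddSubgroup,
      fun Z => by rw [AddSubgroup.mem_inf, Submodule.mem_toAddSubgroup, mem_ker_ad_single_two_zero_iff]⟩
  -- ===== closedness ⇒ local compactness; Borel structures and Haar measures on `↥Q`, `↥C` =====
  have h𝔲₀cl : IsClosed (𝔲₀ : Set (Matrix (Fin 3) (Fin 3) K)) := by
    have : (𝔲₀ : Set (Matrix (Fin 3) (Fin 3) K)) =
        {X : Matrix (Fin 3) (Fin 3) K | (X.map σ)ᵀ * !![(0 : K), 0, 1; 0, 1, 0; 1, 0, 0] + !![(0 : K), 0, 1; 0, 1, 0; 1, 0, 0] * X = 0} ∩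
          {X | Matrix.trace X = 0} := Set.ext fun X => by simpa using h𝔲₀ X
    rw [this]
    exact (isClosed_skew σ _ hσc).inter (isClosed_eq (continuous_id.matrix_trace) continuous_const)
  have hentry : ∀ i j : Fin 3, Continuous fun X : Matrix (Fin 3) (Fin 3) K => X i j := fun i j => continuous_id.matrix_elem i j
  have hQcl : IsClosed (Q : Set (Matrix (Fin 3) (Fin 3) K)) := by
    have : (Q : Set (Matrix (Fin 3) (Fin 3) K)) = (𝔲₀ : Set (Matrix (Fin 3) (Fin 3) K)) ∩
        ({Y | Y 0 1 = 0} ∩ {Y | Y 0 2 = 0} ∩ {Y | Y 1 1 = 0} ∩ {Y | Y 1 2 = 0} ∩ {Y : Matrix (Fin 3) (Fin 3) K | Y 0 0 + Y 2 2 = 0}) := by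
      ext Y; simp only [SetLike.mem_coe, hQ, Set.mem_inter_iff, Set.mem_setOf_eq]; tauto
    rw [this]
    exact h𝔲₀cl.inter (((((isClosed_eq (hentry 0 1) continuous_const).inter (isClosed_eq (hentry 0 2) continuous_const)).inter
      (isClosed_eq (hentry 1 1) continuous_const)).inter (isClosed_eq (hentry 1 2) continuous_const)).inter
      (isClosed_eq ((hentry 0 0).add (hentry 2 2)) continuous_const))
  have hCcl : IsClosed (C : Set (Matrix (Fin 3) (Fin 3) K)) := by
    have : (C : Set (Matrix (Fin 3) (Fin 3) K)) = (𝔲₀ : Set (Matrix (Fin 3) (Fin 3) K)) ∩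
        {Z : Matrix (Fin 3) (Fin 3) K | Z * Matrix.single (2 : Fin 3) (0 : Fin 3) (1 : K) = Matrix.single (2 : Fin 3) (0 : Fin 3) 1 * Z} := by
      ext Z; simp only [SetLike.mem_coe, hC, Set.mem_inter_iff, Set.mem_setOf_eq]
    rw [this]
    exact h𝔲₀cl.inter (isClosed_eq (continuous_id.matrix_mul continuous_const) (continuous_const.matrix_mul continuous_id))
  haveI : LocallyCompactSpace (Matrix (Fin 3) (Fin 3) K) := inferInstanceAs (LocallyCompactSpace (Fin 3 → Fin 3 → K))
  haveI : LocallyCompactSpace ↥Q := hQcl.isClosedEmbedding_subtypeVal.locallyCompactSpace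
  haveI : LocallyCompactSpace ↥C := hCcl.isClosedEmbedding_subtypeVal.locallyCompactSpace
  letI : MeasurableSpace ↥Q := borel _
  haveI : BorelSpace ↥Q := ⟨rfl⟩
  letI : MeasurableSpace ↥C := borel _
  haveI : BorelSpace ↥C := ⟨rfl⟩
  -- ===== the descended chart ★ (F), its `K`-linear form and Newton data ★ (iii-K) (K1)+(K3), box `r = γ = 1∕2` =====
  obtain ⟨e, he⟩ := UnitaryThreeSliceDescent.exists_slice_addEquiv σ h2 hc hc0 𝔲₀ Q C h𝔲₀ hQ hC
  obtain ⟨eK, heK⟩ := exists_slodowyLinearEquivK (K := K) hc0 h2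
  obtain ⟨k₀, hNK⟩ := exists_newtonData_slodowyK c eK heK (r := 1 / 2) (γ := 1 / 2) (by norm_num) (by norm_num) (by norm_num)
  -- ===== ★ FILE C: the two transfers for the class function `ηᵣ` =====
  obtain ⟨W, hW, hdown, hup⟩ := exists_slice_transfers σ hσc hc 𝔲₀ Q C h𝔲₀ hQ hC e he eK heK
    (r := 1 / 2) (γ := 1 / 2) (by norm_num) (by norm_num) (by norm_num) (by norm_num) hNK μ₀ (Measure.addHaar : Measure ↥Q) (Measure.addHaar : Measure ↥C)
    (fun X : Matrix (Fin 3) (Fin 3) K => ((normAbs K (Matrix.charpoly X).discr : ℝ≥0∞)) ^ (-r))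
    (continuous_eta_rpow r) (fun X X' h => by simp only [h])
  -- ===== §3: vertex + classification + (i)(ii) =====
  have hC' : ∀ X, X ∈ C ↔ ((X.map σ)ᵀ * !![(0 : K), 0, 1; 0, 1, 0; 1, 0, 0] + !![(0 : K), 0, 1; 0, 1, 0; 1, 0, 0] * X = 0 ∧ Matrix.trace X = 0) ∧
      X * Matrix.single (2 : Fin 3) (0 : Fin 3) (1 : K) = Matrix.single (2 : Fin 3) (0 : Fin 3) 1 * X := fun X => by rw [hC, h𝔲₀]
  exact exists_nhds_setLIntegral_eta_rpow_lt_top_of_slice_transfers σ hσ h3 ι hι hιr lam hlam rfl hc hc0 𝔲₀ h𝔲₀ μ₀ C hC' (Measure.addHaar : Measure ↥C)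
    hr2 hreg hss hW (fun Z hZ _ => hdown Z hZ) hup

set_option maxHeartbeats 800000 in
-- long statement (three integrands)
include hσ hσc ι hι hιr lam hlam h3 in
/-- **(ε2) HEAD — D5(iii)ᵣ «SQUARE-ZERO POINTS ON `↥𝔲₀`» AT EXPONENT `r`** (the `hsq` binder of (ε6) `K2E3HCDModelRpow`).  Frame R3 (module docstring), `J = J₃` (letter `hJ`),
any additive Haar measure `μ₀` on `↥𝔲₀`, `12 r < 5`; HYPOTHESES (i) `hreg`, (ii) `hss` in ★ GLOBAL-FINAL's letters with the token `ηᵣ`.  CONCLUSION: for every `X₀ : ↥𝔲₀` with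
`X₀ ≠ 0`, `X₀² = 0`, `ηᵣ` has finite `μ₀`-integral on a neighbourhood of `X₀`.  Proof: ★ (E) WITT `X₀ = g N_c g⁻¹` with `g` unitary, `σ c = −c`, `c ≠ 0`; ★ (AD) `Ad(g) : ↥𝔲₀ ≃ₜ+ ↥𝔲₀`
transports local finiteness of the `Ad`-invariant `ηᵣ` (★ `discr_charpoly_conj_eq`) from `N_c` (§4) to `X₀` (★ `exists_nhds_setLIntegral_lt_top_iff_ad`).  Binders = ★
`…SlodowySliceFinal.exists_nhds_setLIntegral_etaInv_lt_top_of_sq_zero` + `{r} (hr5)` before `hreg`. [cite: HarishChandra1970, Part VII §1 Thm. 15]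
[cite: Rogawski1990, §1.9 p. 8; §4.9 p. 54] [cite: Slodowy1980, §7.4] -/
theorem exists_nhds_setLIntegral_eta_rpow_lt_top_of_sq_zero
    {J : Matrix (Fin 3) (Fin 3) K} (hJ : J = !![0, 0, 1; 0, 1, 0; 1, 0, 0])
    (𝔲₀ : AddSubgroup (Matrix (Fin 3) (Fin 3) K)) (h𝔲₀ : ∀ X, X ∈ 𝔲₀ ↔ (X.map σ)ᵀ * J + J * X = 0 ∧ Matrix.trace X = 0)
    [MeasurableSpace ↥𝔲₀] [BorelSpace ↥𝔲₀] (μ₀ : Measure ↥𝔲₀) [μ₀.IsAddHaarMeasure] {r : ℝ} (hr5 : 12 * r < 5)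
    (hreg : ∀ X₀ : ↥𝔲₀, LinearIndependent K ![(1 : Matrix (Fin 3) (Fin 3) K), (X₀ : Matrix (Fin 3) (Fin 3) K), (X₀ : Matrix (Fin 3) (Fin 3) K) ^ 2] →
      ∃ U ∈ 𝓝 X₀, ∫⁻ X in U, ((normAbs K (Matrix.charpoly (X : Matrix (Fin 3) (Fin 3) K)).discr : ℝ≥0∞)) ^ (-r) ∂μ₀ < ∞)
    (hss : ∀ X₀ : ↥𝔲₀, (∃ a b : K, a ≠ b ∧ ((X₀ : Matrix (Fin 3) (Fin 3) K) - a • (1 : Matrix (Fin 3) (Fin 3) K)) * ((X₀ : Matrix (Fin 3) (Fin 3) K) - b • 1) = 0 ∧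
        ∀ a' : K, (X₀ : Matrix (Fin 3) (Fin 3) K) ≠ a' • 1) →
      ∃ U ∈ 𝓝 X₀, ∫⁻ X in U, ((normAbs K (Matrix.charpoly (X : Matrix (Fin 3) (Fin 3) K)).discr : ℝ≥0∞)) ^ (-r) ∂μ₀ < ∞) :
    ∀ X₀ : ↥𝔲₀, X₀ ≠ 0 → (X₀ : Matrix (Fin 3) (Fin 3) K) * (X₀ : Matrix (Fin 3) (Fin 3) K) = 0 →
      ∃ U ∈ 𝓝 X₀, ∫⁻ X in U, ((normAbs K (Matrix.charpoly (X : Matrix (Fin 3) (Fin 3) K)).discr : ℝ≥0∞)) ^ (-r) ∂μ₀ < ∞ := by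
  classical
  subst hJ
  intro X₀ hX₀ hsq
  obtain ⟨hX₀skew, -⟩ := (h𝔲₀ _).1 X₀.2
  have hX₀0 : (X₀ : Matrix (Fin 3) (Fin 3) K) ≠ 0 := fun h => hX₀ (Subtype.ext h)
  -- ★ (E) Witt: `X₀ = g N_c g⁻¹`
  obtain ⟨g, c, hg, hc, hc0, hXg⟩ := UnitaryThreeWitt.exists_unitary_conj_single_zero_two σ hσ hX₀skew hX₀0 hsq
  have hdet : IsUnit g.det := UnitaryThreeWitt.isUnit_det_of_unitary σ hg
  -- ★ (AD): `Ad(g)` on `↥𝔲₀`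
  obtain ⟨Adg, hAdg, hAdgsymm⟩ := exists_adEquiv_traceZero σ hσ rfl 𝔲₀ h𝔲₀ hg
  have hN : ((Adg.symm X₀ : ↥𝔲₀) : Matrix (Fin 3) (Fin 3) K) = Matrix.single (0 : Fin 3) (2 : Fin 3) c := by
    rw [hAdgsymm, hXg]
    simp only [← Matrix.mul_assoc]
    rw [Matrix.nonsing_inv_mul _ hdet, Matrix.one_mul, Matrix.mul_assoc, Matrix.nonsing_inv_mul _ hdet, Matrix.mul_one]
  -- instances for the transport lemma
  have h𝔲₀cl : IsClosed (𝔲₀ : Set (Matrix (Fin 3) (Fin 3) K)) := by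
    haveI : T2Space K := (IsNonarchimedeanLocalField.isLocalField K).toT2Space
    have hlin : Continuous fun X : Matrix (Fin 3) (Fin 3) K => (X.map σ)ᵀ * !![(0 : K), 0, 1; 0, 1, 0; 1, 0, 0] + !![(0 : K), 0, 1; 0, 1, 0; 1, 0, 0] * X :=
      (((continuous_id.matrix_map hσc).matrix_transpose.matrix_mul continuous_const).add (continuous_const.matrix_mul continuous_id))
    have : (𝔲₀ : Set (Matrix (Fin 3) (Fin 3) K)) =
        {X : Matrix (Fin 3) (Fin 3) K | (X.map σ)ᵀ * !![(0 : K), 0, 1; 0, 1, 0; 1, 0, 0] + !![(0 : K), 0, 1; 0, 1, 0; 1, 0, 0] * X = 0} ∩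
          {X | Matrix.trace X = 0} := Set.ext fun X => by simpa using h𝔲₀ X
    rw [this]
    exact (isClosed_eq hlin continuous_const).inter (isClosed_eq (continuous_id.matrix_trace) continuous_const)
  haveI : SecondCountableTopology K := Literature.NumberTheory.Automorphic.secondCountableTopology_localField K
  haveI : SecondCountableTopology (Matrix (Fin 3) (Fin 3) K) := inferInstanceAs (SecondCountableTopology (Fin 3 → Fin 3 → K))
  haveI : SecondCountableTopology ↥𝔲₀ := TopologicalSpace.Subtype.secondCountableTopology _
  haveI : LocallyCompactSpace (Matrix (Fin 3) (Fin 3) K) := inferInstanceAs (LocallyCompactSpace (Fin 3 → Fin 3 → K))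
  haveI : LocallyCompactSpace ↥𝔲₀ := h𝔲₀cl.isClosedEmbedding_subtypeVal.locallyCompactSpace
  -- §4 at `N_c = Adg.symm X₀`, transported along `Ad(g)` (the integrand is `Ad`-invariant: ★ `discr_charpoly_conj_eq`)
  have key := exists_nhds_setLIntegral_eta_rpow_lt_top_of_eq_single σ hσ hσc h3 ι hι hιr lam hlam rfl hc hc0 𝔲₀ h𝔲₀ μ₀ hr5 hreg hss (Adg.symm X₀) hN
  have h := (exists_nhds_setLIntegral_lt_top_iff_ad 𝔲₀ μ₀ Adg
    (fun X : ↥𝔲₀ => ((normAbs K (Matrix.charpoly (X : Matrix (Fin 3) (Fin 3) K)).discr : ℝ≥0∞)) ^ (-r))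
    (fun X => by simp only [hAdg, discr_charpoly_conj_eq hdet]) (Adg.symm X₀)).1 key
  rwa [ContinuousAddEquiv.apply_symm_apply] at h

end Final

end Summit.HodgeConjecture.HodgeConjecture.Cruxes.H413.K2E3HCDSlodowySliceRpow

end
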